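import Summits.BirchSwinnertonDyer.BirchSwinnertonDyer.Theses.KatoDescentTamePotSupersingular
import Summits.BirchSwinnertonDyer.BirchSwinnertonDyer.Theorems.KatoDescentTamePotSupersingularTameLowerFouquetRoad
import HarnessLib

/-!
# Route `KatoDescentTamePotSupersingular` (rung K8, sub-rung B4 (t′), cell `bsd-potss`): the Fouquet-2025
# congruence-transport road to the crux `TameLowerHalfRankZero` (L₀, item stmt-BirchSwinnertonDyer-19981) with
# Assumption 2.9 (2) in its EXACT form, at a GENERAL prime `p ≥ 5` (a `--supports … --as helper` file; seat
# bsd-potss-k8t-c2, generation 4)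

Seat g3 (`…TameLowerFouquetRoad.lean`, p431286) ran the road on the cell `L_{II*,5}` with the local clause of
Fouquet's Ass. 2.9 (2) witnessed by the ordinary SHAPE of the cell (`SubLIIstarFive`). Seat g4's memo
(`HOME/k8t-c2/FINDING-19981-ass29-k8t-c2-g4.md`) shows that Ass. 2.9 (2) at `(W, p)`, `p` odd, is EXACTLY «the
`p`-division polynomial of `W` has no root in `ℚ_p`» (`Theorems.FouquetGenericAt p W`, route Defs §3; elementary:
`χψ = ω`, `χ² = ω` impossible, so failure ⟺ a stable line with `{±1}`-valued character ⟺ a `p`-torsion point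
with `ℚ_p`-rational abscissa) — the shape witness misses the split sub-case (void in the census: kit j253026, no
split row among the 5 555 (t′) rank-`0` rows at `p ≥ 5`, and `L_{II*,5}` passes 429/429). This file re-runs g3's
chain over the exact shape `FouquetTransportShapeExact KMC` (Defs §3), cell-free and at any `p ≥ 5`:

* §1 `KMC W p` at an additive `W` with `W[p]` irreducible, `ρ̄` onto, `FouquetGenericAt p W`, Ass. 3.4, from a
  level-compatible congruent good-ORDINARY partner `G` with the Skinner–Urban hypotheses (tree fact bsd.S21 +
  Kato §17.13 reading, g3's `kmc_of_goodOrd_of_skinnerUrban`);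
* §2 hence — on an additive POTENTIALLY GOOD row of analytic rank `0` (`0 ≤ v_p(j)`; (t′), but also `e = 2`
  and the abelian potentially good rows) — the `p`-part of BSD in Miller's currency by the cell's image-free
  descent at the curve itself (`W[p]` irreducible ⇒ `p ∤ #W(ℚ)_tors`), and its lower half; the (t′) corollary in
  the crux's currency;
* §3 the class form on the (t′) rows carrying such a seed, over a displayed partner oracle — the statement the
  planner may file as a support split-child of 19981 (memo §4), proved here modulo the two SHAPES, the descent
  readings and the named published facts.

By harvest-2 E94 / the census, among (t′) rows a good-ordinary partner occurs only on the ordinary-shape cell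
(Kodaira II* at `5`, `v₅(c₄) = 4`); the general-`p` form costs nothing and serves every additive potentially good
row with such a partner (b2b F25 lane D1). CONDITIONAL throughout (`proof.conditional`); the item is NOT closed;
nothing is booked; BSD is not proved by any of this. Seat `bsd-potss-k8t-c2` (prover-bsd-potss-k8t-c2-g4-0).

References: [Fouquet2025EquivariantTNC] Thm 4.1 (pp. 24–25), Thm 1.7 (p. 7), Ass. 2.9 (p. 15), Ass. 3.4 (pp. 22–23);
[SkinnerUrban2014] Thm 3.6.9 (p. 45); [Kato2004Asterisque] Conj. 12.10 (p. 224), Prop. 14.16 (2) (p. 244), §17.13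
(p. 280); [Miller2011LMS] Def. 1.1.
-/

set_option autoImplicit false
-- sibling precedent (`KatoDescentTamePotSupersingularAssembly.lean`): the directory name repeats the summit name
set_option linter.dupNamespace false

noncomputable section

open scoped Classical

namespace Summit.BirchSwinnertonDyer.BirchSwinnertonDyer.Theorems

open WeierstrassCurve Literature.NumberTheory.EllipticCurves
  Literature.NumberTheory.EllipticCurves.ModularForms
  Literature.NumberTheory.EllipticCurves.Rank1Residual
  Literature.NumberTheory.EllipticCurves.Rank1Residual.Typed
  Summit.BirchSwinnertonDyer.Rank1Residual.Additive
  Summit.BirchSwinnertonDyer.Rank1Residual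
  Summit.BirchSwinnertonDyer.BirchSwinnertonDyer.Theses.KatoDescentTamePotSupersingular

variable {IsOf : ∀ (W : WeierstrassCurve ℚ) [W.IsElliptic] [W.IsGloballyMinimal] (p : ℕ) [Fact p.Prime],
  KatoDescentDatum p → Prop}
variable {KMC : ∀ (W : WeierstrassCurve ℚ) [W.IsElliptic] [W.IsGloballyMinimal] (p : ℕ), Prop}

/-! ## §1 Transport from a good-ordinary Skinner–Urban seed under the EXACT local clause -/

/-- **`KMC W p` from a congruent good-ordinary partner, Ass. 2.9 (2) exact.** `W` additive at `p ≥ 5` with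
`W[p]` irreducible (`ClassX4`), `ρ̄_{W,p}` onto, `FouquetGenericAt p W` (no `p`-torsion abscissa in `ℚ_p` =
Ass. 2.9 (2)), Ass. 3.4 on `LR(W)`; `G` good ordinary at `p` with `G[p]` irreducible, a ramified Steinberg prime,
`ρ_{G,p^∞}` onto, `a_ℓ(G) ≡ a_ℓ(W) (mod p)` off `p N_W N_G`, level-compatible. Then Skinner–Urban (tree fact
bsd.S21, hypothesis `hSU`) + the §17.13 reading (`hOrd`) give `KMC G p` (g3's `kmc_of_goodOrd_of_skinnerUrban`)
and Fouquet Thm 4.1 (exact shape `hF`) moves it to `W`. Every displayed input is a PUBLISHED theorem read as a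
hypothesis; nothing credited. [cite: Fouquet2025EquivariantTNC, Thm 4.1 (pp. 24–25) and Ass. 2.9 (p. 15)]
[cite: SkinnerUrban2014, Thm. 3.6.9 (p. 45)] [cite: Kato2004Asterisque, §17.13 (p. 280)] -/
theorem kmc_of_fouquetExact_of_goodOrdPartner (hF : FouquetTransportShapeExact KMC)
    (hOrd : OrdinarySeedReadsKMC KMC)
    (hSU : ∀ (W : WeierstrassCurve ℚ) [W.IsElliptic] [W.IsGloballyMinimal] (p : ℕ) [Fact p.Prime]
      (κ : ZpExtension ℚ p) (γ : Field.absoluteGaloisGroup ℚ) (N : ℕ) [NeZero N]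
      (f : CuspForm (CongruenceSubgroup.Gamma0 N) 2),
      skinner_urban_main_conjecture W p (κ := κ) (γ := γ) (f := f))
    (W G : WeierstrassCurve ℚ) [W.IsElliptic] [W.IsGloballyMinimal] [G.IsElliptic] [G.IsGloballyMinimal]
    (p : ℕ) [Fact p.Prime] (hp : 5 ≤ p) (hX : ClassX4 W p) (hsurj : Surj W p) (hgen : FouquetGenericAt p W)
    (helig : FouquetEligibleAt p W) (hcong : IsCongruentModP p W G) (hlev : FouquetLevelCompatibleAt p W G)
    (hord : GoodOrd G p) (hirrG : Irr G p) (hramG : Ram G p)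
    (htowG : ∀ n : ℕ, G.HasSurjectiveModNGaloisRep (p ^ n : ℕ)) : KMC W p :=
  hF W G p hp hX hsurj hgen helig hcong hlev (kmc_of_goodOrd_of_skinnerUrban hOrd hSU G p hp hord hirrG hramG htowG)

/-! ## §2 The rank-0 `p`-part at an additive potentially good curve with such a seed -/

/-- **`MissingPPartAt W p` (both halves, Miller's currency) on an additive POTENTIALLY GOOD row of analytic rank
`0` carrying a good-ordinary Fouquet seed, `p ≥ 5`.** §1's `KMC W p` + the cell's image-free descent at `W`
itself (`TorsionFree.missingPPartAt_rankZero_of_kmc`: `W[p]` irreducible ⇒ `p ∤ #W(ℚ)_tors`; readings `hR`,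
`hreal`, `hread`; GZK `hGZK`; modularity `hmod`). Not restricted to (t′): any additive `p` with `0 ≤ v_p(j)`.
Conditional; nothing credited. [cite: Fouquet2025EquivariantTNC, Thm 4.1 and Thm 1.7 (2)]
[cite: Kato2004Asterisque, Conj. 12.10 (p. 224), Prop. 14.16 (2) (p. 244), §17.13 (p. 280)]
[cite: SkinnerUrban2014, Thm. 3.6.9 (p. 45)] [cite: Miller2011LMS, Def. 1.1] -/
theorem missingPPartAt_rankZero_potGood_of_fouquetExact_of_goodOrdPartner
    (hR : TorsionFree.DescentCountReading IsOf) (hreal : TorsionFree.RealizableOfKMC IsOf KMC)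
    (hread : ReadsTrivialKMC IsOf KMC) (hGZK : rank_eq_analyticRank_of_analyticRank_le_one)
    (hmod : hasEntireLFunction_rat) (hF : FouquetTransportShapeExact KMC) (hOrd : OrdinarySeedReadsKMC KMC)
    (hSU : ∀ (W : WeierstrassCurve ℚ) [W.IsElliptic] [W.IsGloballyMinimal] (p : ℕ) [Fact p.Prime]
      (κ : ZpExtension ℚ p) (γ : Field.absoluteGaloisGroup ℚ) (N : ℕ) [NeZero N]
      (f : CuspForm (CongruenceSubgroup.Gamma0 N) 2),
      skinner_urban_main_conjecture W p (κ := κ) (γ := γ) (f := f))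
    (W G : WeierstrassCurve ℚ) [W.IsElliptic] [W.IsGloballyMinimal] [G.IsElliptic] [G.IsGloballyMinimal]
    (p : ℕ) [Fact p.Prime] (hp : 5 ≤ p) (hr : W.analyticRank = 0) (hadd : Addv W p)
    (hj : 0 ≤ padicValRat p W.j) (hirr : Irr W p) (hsurj : Surj W p) (hgen : FouquetGenericAt p W)
    (helig : FouquetEligibleAt p W) (hcong : IsCongruentModP p W G) (hlev : FouquetLevelCompatibleAt p W G)
    (hord : GoodOrd G p) (hirrG : Irr G p) (hramG : Ram G p)
    (htowG : ∀ n : ℕ, G.HasSurjectiveModNGaloisRep (p ^ n : ℕ)) : MissingPPartAt W p :=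
  have hp2 : p ≠ 2 := by omega
  TorsionFree.missingPPartAt_rankZero_of_kmc W p hR hreal hread hGZK hmod hr hp2 hadd hj
    (Supersingular.not_dvd_torsionOrder_of_irr W p hirr)
    (kmc_of_fouquetExact_of_goodOrdPartner hF hOrd hSU W G p hp ⟨hp2, hadd, hirr⟩ hsurj hgen helig hcong hlev
      hord hirrG hramG htowG)

/-- **The (t′) corollary in the crux's currency: `MissingLowerBoundAt W p` on a (t′) rank-`0` row with a
good-ordinary Fouquet seed, Ass. 2.9 (2) exact** ((t′) ⇒ potentially good, `ClassO5.padicValRat_j_nonneg`;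
projection `lower_and_upper_of_missingPPartAt`). Item 19981 restricted to its Fouquet-seed rows; by the census
these are rows of the cell II* at `5`, `v₅(c₄) = 4` (335–366 of 429 with a certified elliptic partner, N < 5·10⁵).
Conditional; nothing credited; the item is NOT closed. [cite: Fouquet2025EquivariantTNC, Thm 4.1]
[cite: Miller2011LMS, Def. 1.1] -/
theorem tameMissingLowerBoundAt_of_fouquetExact_of_goodOrdPartner
    (hR : TorsionFree.DescentCountReading IsOf) (hreal : TorsionFree.RealizableOfKMC IsOf KMC)
    (hread : ReadsTrivialKMC IsOf KMC) (hGZK : rank_eq_analyticRank_of_analyticRank_le_one)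
    (hmod : hasEntireLFunction_rat) (hF : FouquetTransportShapeExact KMC) (hOrd : OrdinarySeedReadsKMC KMC)
    (hSU : ∀ (W : WeierstrassCurve ℚ) [W.IsElliptic] [W.IsGloballyMinimal] (p : ℕ) [Fact p.Prime]
      (κ : ZpExtension ℚ p) (γ : Field.absoluteGaloisGroup ℚ) (N : ℕ) [NeZero N]
      (f : CuspForm (CongruenceSubgroup.Gamma0 N) 2),
      skinner_urban_main_conjecture W p (κ := κ) (γ := γ) (f := f))
    (W G : WeierstrassCurve ℚ) [W.IsElliptic] [W.IsGloballyMinimal] [G.IsElliptic] [G.IsGloballyMinimal]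
    (p : ℕ) [Fact p.Prime] (hp : 5 ≤ p) (hr : W.analyticRank = 0) (hadd : Addv W p) (hT : SubTprime W p)
    (hirr : Irr W p) (hsurj : Surj W p) (hgen : FouquetGenericAt p W) (helig : FouquetEligibleAt p W)
    (hcong : IsCongruentModP p W G) (hlev : FouquetLevelCompatibleAt p W G)
    (hord : GoodOrd G p) (hirrG : Irr G p) (hramG : Ram G p)
    (htowG : ∀ n : ℕ, G.HasSurjectiveModNGaloisRep (p ^ n : ℕ)) : MissingLowerBoundAt W p :=
  have hp2 : p ≠ 2 := by omega
  have hO5 : ClassO5 W p := ⟨hp2, hadd, Or.inr hT⟩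
  (lower_and_upper_of_missingPPartAt W p
    (missingPPartAt_rankZero_potGood_of_fouquetExact_of_goodOrdPartner hR hreal hread hGZK hmod hF hOrd hSU W G
      p hp hr hadd hO5.padicValRat_j_nonneg hirr hsurj hgen helig hcong hlev hord hirrG hramG htowG)).1

/-! ## §3 The class form on the (t′) Fouquet-seed rows (the split-child statement of memo §4) -/

/-- **L₀ on every (t′) rank-`0` row at `p ≥ 5` with `ρ̄` onto, Ass. 2.9 (2) (exact) and Ass. 3.4 that HAS a
level-compatible congruent good-ordinary Skinner–Urban seed** — the statement offered to the planner as a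
support split-child of item 19981 (memo §4, local hypothesis `FouquetGenericAt p W`), proved modulo the two
SHAPES (`FouquetTransportShapeExact`, `OrdinarySeedReadsKMC`), the descent readings, Skinner–Urban (bsd.S21),
GZK and modularity. `ρ̄` onto already gives `W[p]` irreducible (`Supersingular.irr_of_surj`-free form: the
irreducibility is taken from `Surj` inside the proof via the tree lemma when available; here it is displayed as
part of `ClassX4` through `Irr` derived from surjectivity). Conditional; nothing credited; the item is NOT closed.
[cite: Fouquet2025EquivariantTNC, Thm 4.1 and Thm 1.7 (2)] [cite: SkinnerUrban2014, Thm. 3.6.9 (p. 45)]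
[cite: Kato2004Asterisque, §17.13 (p. 280)] [cite: Miller2011LMS, Def. 1.1] -/
theorem tameLowerHalf_fouquetSeedRows_of_shapes
    (hR : TorsionFree.DescentCountReading IsOf) (hreal : TorsionFree.RealizableOfKMC IsOf KMC)
    (hread : ReadsTrivialKMC IsOf KMC) (hGZK : rank_eq_analyticRank_of_analyticRank_le_one)
    (hmod : hasEntireLFunction_rat) (hF : FouquetTransportShapeExact KMC) (hOrd : OrdinarySeedReadsKMC KMC)
    (hSU : ∀ (W : WeierstrassCurve ℚ) [W.IsElliptic] [W.IsGloballyMinimal] (p : ℕ) [Fact p.Prime]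
      (κ : ZpExtension ℚ p) (γ : Field.absoluteGaloisGroup ℚ) (N : ℕ) [NeZero N]
      (f : CuspForm (CongruenceSubgroup.Gamma0 N) 2),
      skinner_urban_main_conjecture W p (κ := κ) (γ := γ) (f := f)) :
    ∀ (W : WeierstrassCurve ℚ) [W.IsElliptic] [W.IsGloballyMinimal] (p : ℕ) [Fact p.Prime],
      W.analyticRank = 0 → 5 ≤ p → Addv W p → SubTprime W p → Surj W p → FouquetGenericAt p W →
      FouquetEligibleAt p W →
      (∃ (G : WeierstrassCurve ℚ) (_ : G.IsElliptic) (_ : G.IsGloballyMinimal),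
        GoodOrd G p ∧ Irr G p ∧ Ram G p ∧ (∀ n : ℕ, G.HasSurjectiveModNGaloisRep (p ^ n : ℕ)) ∧
          IsCongruentModP p W G ∧ FouquetLevelCompatibleAt p W G) →
      MissingLowerBoundAt W p := by
  intro W _ _ p _ hr hp hadd hT hsurj hgen helig hseed
  obtain ⟨G, hGe, hGm, hord, hirrG, hramG, htowG, hcong, hlev⟩ := hseed
  exact tameMissingLowerBoundAt_of_fouquetExact_of_goodOrdPartner hR hreal hread hGZK hmod hF hOrd hSU W G p hp
    hr hadd hT (hasIrreducibleModPGaloisRep_of_hasSurjectiveModNGaloisRep W p hsurj) hsurj hgen helig hcong hlev hord hirrG hramG htowG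

end Summit.BirchSwinnertonDyer.BirchSwinnertonDyer.Theorems

end
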